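import Summits.QuantumAdvantage.AdviceFreeQNC0.TripleProjection
import HarnessLib

/-!
# Cell qa-qnc0 — the AP-MAJ₃ TRIPLE IDENTITY (planner qa-qnc0-p1 g19, ROUND-18 §3.9; `exp19/Sketch19.lean` §8,
definitions `maj3`, `apMaj3` VERBATIM)

The AP-MAJ₃ far template: output `z_j = t_j(x) ⊕ MAJ(x_{j+h}, x_{j+2h}, x_{j+3h})`.  With
`Q = {s+h, s+2h, s+3h} ⊆ particles of J(x)` (`2 ≤ h`, `4h < n`), the triple-projection engine
(`master_identity`, `projQ_evenSubsets_eq_false`) gives the J-ONLY identity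

  `#{F ∈ evenSubsets Q : WIN(x^F)} ≡ J_{s-h} + J_s (mod 2)`      (`apMaj3_triple`):

the bells `s-h, s, s+h` own `Q` (each reads ≥ 2 of its coordinates) and have projection `1` (MAJ₃ has odd
weight on both parity cosets of the cube: `sum_maj3_coset`), every other bell ignores two coordinates of `Q`
and drops out; `J_{s+h} = 0`.  Positions are handled in the commutative ring structure of `Fin n`
(`shift h j = j + h`).

WHAT THIS IS NOT: the rung `ApMaj3Lt` is the next file; crux 22907 untouched; separation NOT moved.
-/

namespace Summit.QuantumAdvantage.AdviceFreeQNC0.Fib19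

open Finset Literature.Computability.QuantumComplexity Literature.Computability.QuantumComplexity.RingHLF
open Fin.CommRing

variable {n : ℕ}

/-! ### §8 vocabulary (Sketch19 §5/§8, verbatim) -/

/-- Cyclic shift of a position by `h`. -/
def shift (h : ℕ) (j : Fin n) : Fin n := ⟨(j.val + h) % n, Nat.mod_lt _ j.pos⟩

/-- `MAJ₃`. -/
def maj3 (a b c : Bool) : Bool := (a && b) || (a && c) || (b && c)

/-- The AP-MAJ₃ far template: output `z_j = t_j(x) ⊕ MAJ(x_{j+h}, x_{j+2h}, x_{j+3h})`. -/
def apMaj3 (h : ℕ) (x : Fin n → Bool) : Fin n → Bool :=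
  fun j => xor (tGuess x j) (maj3 (x (shift h j)) (x (shift (2 * h) j)) (x (shift (3 * h) j)))

/-! ### Positions in the ring `Fin n` -/

/-- `shift h j = j + h` in the ring `Fin n`. -/
theorem shift_eq_add [NeZero n] (h : ℕ) (j : Fin n) : shift h j = j + (h : Fin n) := by
  apply Fin.ext
  rw [Fin.val_add, Fin.val_natCast, Nat.add_mod_mod]
  rfl

/-- A positive natural below `n` is non-zero in `Fin n`. -/
theorem natCast_ne_zero_of_lt [NeZero n] {m : ℕ} (h0 : 0 < m) (hm : m < n) : (m : Fin n) ≠ 0 := by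
  rw [Ne, Fin.natCast_eq_zero]
  exact fun hd => absurd (Nat.le_of_dvd h0 hd) (by omega)

/-! ### The stake and what it reads -/

/-- The stake of the AP-MAJ₃ template is `MAJ(x_{j+h}, x_{j+2h}, x_{j+3h})` (the `t`-part cancels). -/
theorem stake_apMaj3 (h : ℕ) (x : Fin n → Bool) (j : Fin n) :
    stake (apMaj3 h) x j = maj3 (x (shift h j)) (x (shift (2 * h) j)) (x (shift (3 * h) j)) := by
  unfold stake apMaj3
  cases tGuess x j <;> cases maj3 (x (shift h j)) (x (shift (2 * h) j)) (x (shift (3 * h) j)) <;> rfl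

/-- Bell `j` of the AP-MAJ₃ template ignores every coordinate it does not read. -/
theorem ignores_apMaj3 (h : ℕ) (j q : Fin n) (h1 : q ≠ shift h j) (h2 : q ≠ shift (2 * h) j)
    (h3 : q ≠ shift (3 * h) j) : Ignores (stake (apMaj3 h)) j q := by
  intro x
  rw [stake_apMaj3, stake_apMaj3, flipAt_apply_of_not_mem (by simpa using h1.symm),
    flipAt_apply_of_not_mem (by simpa using h2.symm), flipAt_apply_of_not_mem (by simpa using h3.symm)]

/-- MAJ₃ has odd weight on both parity cosets of the cube: flipping a PAIR of its inputs in the three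
possible ways plus the identity, the four values sum to `1` in `𝔽₂`. -/
theorem sum_maj3_coset (a b c : Bool) :
    bitVal (maj3 a b c) + bitVal (maj3 (!a) (!b) c) + bitVal (maj3 (!a) b (!c)) + bitVal (maj3 a (!b) (!c)) = 1 := by
  cases a <;> cases b <;> cases c <;> decide

/-- MAJ₃ with one input fixed: over the four sign patterns of the other two inputs the values sum to `1`. -/
theorem sum_maj3_two (a b c : Bool) :
    bitVal (maj3 a b c) + bitVal (maj3 a (!b) (!c)) + bitVal (maj3 a (!b) c) + bitVal (maj3 a b (!c)) = 1 := by
  cases a <;> cases b <;> cases c <;> decide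

/-- MAJ₃ with the last input fixed: over the four sign patterns of the first two the values sum to `1`. -/
theorem sum_maj3_two' (a b c : Bool) :
    bitVal (maj3 a b c) + bitVal (maj3 (!a) b c) + bitVal (maj3 a (!b) c) + bitVal (maj3 (!a) (!b) c) = 1 := by
  cases a <;> cases b <;> cases c <;> decide

/-! ### The even subsets of a triple -/

/-- The even subsets of a triple `{q₁, q₂, q₃}` of distinct positions. -/
theorem evenSubsets_triple {q₁ q₂ q₃ : Fin n} (h12 : q₁ ≠ q₂) (h13 : q₁ ≠ q₃) (h23 : q₂ ≠ q₃) :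
    evenSubsets ({q₁, q₂, q₃} : Finset (Fin n)) = {∅, {q₁, q₂}, {q₁, q₃}, {q₂, q₃}} := by
  ext F
  simp only [evenSubsets, mem_filter, mem_powerset]
  constructor
  · rintro ⟨hF, hev⟩
    -- `F` is determined by which of the three points it contains
    have hFeq : F = ({q₁, q₂, q₃} : Finset (Fin n)).filter fun q => q ∈ F := by
      ext q
      simp only [mem_filter, mem_insert, mem_singleton]
      constructor
      · intro hq
        have := hF hq
        simp only [mem_insert, mem_singleton] at this
        exact ⟨this, hq⟩
      · exact fun h => h.2
    rw [hFeq] at hev ⊢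
    by_cases a : q₁ ∈ F <;> by_cases b : q₂ ∈ F <;> by_cases c : q₃ ∈ F <;>
      simp [filter_insert, filter_singleton, a, b, c, h12, h13, h23] at hev ⊢
  · intro hF
    simp only [mem_insert, mem_singleton] at hF
    rcases hF with rfl | rfl | rfl | rfl
    · simp
    · refine ⟨?_, by rw [card_pair h12]⟩
      intro q hq; simp only [mem_insert, mem_singleton] at hq ⊢; tauto
    · refine ⟨?_, by rw [card_pair h13]⟩
      intro q hq; simp only [mem_insert, mem_singleton] at hq ⊢; tauto
    · refine ⟨?_, by rw [card_pair h23]⟩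
      intro q hq; simp only [mem_insert, mem_singleton] at hq ⊢; tauto

/-- Summing over the even subsets of a triple. -/
theorem sum_evenSubsets_triple {M : Type*} [AddCommMonoid M] {q₁ q₂ q₃ : Fin n} (h12 : q₁ ≠ q₂)
    (h13 : q₁ ≠ q₃) (h23 : q₂ ≠ q₃) (g : Finset (Fin n) → M) :
    ∑ F ∈ evenSubsets ({q₁, q₂, q₃} : Finset (Fin n)), g F = g ∅ + g {q₁, q₂} + g {q₁, q₃} + g {q₂, q₃} := by
  rw [evenSubsets_triple h12 h13 h23]
  have e1 : (∅ : Finset (Fin n)) ≠ {q₁, q₂} := fun e => by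
    have hq : q₁ ∈ ({q₁, q₂} : Finset (Fin n)) := by simp
    rw [← e] at hq; simp at hq
  have e2 : (∅ : Finset (Fin n)) ≠ {q₁, q₃} := fun e => by
    have hq : q₁ ∈ ({q₁, q₃} : Finset (Fin n)) := by simp
    rw [← e] at hq; simp at hq
  have e3 : (∅ : Finset (Fin n)) ≠ {q₂, q₃} := fun e => by
    have hq : q₂ ∈ ({q₂, q₃} : Finset (Fin n)) := by simp
    rw [← e] at hq; simp at hq
  have e4 : ({q₁, q₂} : Finset (Fin n)) ≠ {q₁, q₃} := fun e => by
    have hq : q₂ ∈ ({q₁, q₂} : Finset (Fin n)) := by simp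
    rw [e] at hq; simp only [mem_insert, mem_singleton] at hq
    rcases hq with hq | hq
    · exact h12 hq.symm
    · exact h23 hq
  have e5 : ({q₁, q₂} : Finset (Fin n)) ≠ {q₂, q₃} := fun e => by
    have hq : q₁ ∈ ({q₁, q₂} : Finset (Fin n)) := by simp
    rw [e] at hq; simp only [mem_insert, mem_singleton] at hq
    rcases hq with hq | hq
    · exact h12 hq
    · exact h13 hq
  have e6 : ({q₁, q₃} : Finset (Fin n)) ≠ {q₂, q₃} := fun e => by
    have hq : q₁ ∈ ({q₁, q₃} : Finset (Fin n)) := by simp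
    rw [e] at hq; simp only [mem_insert, mem_singleton] at hq
    rcases hq with hq | hq
    · exact h12 hq
    · exact h13 hq
  rw [sum_insert (by simp [e1, e2, e3]), sum_insert (by simp [e4, e5]), sum_insert (by simp [e6]),
    sum_singleton]
  simp only [add_assoc]

/-! ### Flips at a pair -/

/-- A pair flip negates its first point. -/
theorem flipAt_pair_left (x : Fin n → Bool) (a b : Fin n) : flipAt x {a, b} a = !x a :=
  flipAt_apply_of_mem (by simp)

/-- A pair flip negates its second point. -/
theorem flipAt_pair_right (x : Fin n → Bool) (a b : Fin n) : flipAt x {a, b} b = !x b :=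
  flipAt_apply_of_mem (by simp)

/-- A pair flip fixes every other point. -/
theorem flipAt_pair_other (x : Fin n → Bool) {a b c : Fin n} (h1 : c ≠ a) (h2 : c ≠ b) :
    flipAt x {a, b} c = x c :=
  flipAt_apply_of_not_mem (by simp [h1, h2])

/-- The empty flip. -/
theorem flipAt_empty (x : Fin n → Bool) : flipAt x ∅ = x :=
  funext fun i => flipAt_apply_of_not_mem (by simp)

/-! ### The triple identity -/

/-- **AP-MAJ₃ TRIPLE IDENTITY** (ROUND-18 §3.9; planner's numerics exp19/triple_check.py (1): 0/30017 mismatches).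
With `Q = {s+h, s+2h, s+3h} ⊆` particles, the owners of `Q` are the bells `s-h, s, s+h`, each with projection `1`;
the bell `s+h ∈ Q` is a particle, so `#{F ∈ evenSubsets Q : WIN(x^F)} ≡ J_{s-h} + J_s (mod 2)` — a J-ONLY
identity. -/
theorem apMaj3_triple (h : ℕ) (hh : 2 ≤ h) (hn : 4 * h < n) (x : Fin n → Bool) (hodd : IsOdd x) (s : Fin n)
    (hQ1 : kline x (shift h s) = false) (hQ2 : kline x (shift (2 * h) s) = false)
    (hQ3 : kline x (shift (3 * h) s) = false) :
    haveI : DecidablePred (fun F : Finset (Fin n) => Rel (flipAt x F) (apMaj3 h (flipAt x F))) :=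
      fun _ => Classical.propDecidable _
    ((evenSubsets ({shift h s, shift (2 * h) s, shift (3 * h) s} : Finset (Fin n))).filter
        fun F => Rel (flipAt x F) (apMaj3 h (flipAt x F))).card % 2 =
      (Bool.toNat (kline x (shift (n - h) s)) + Bool.toNat (kline x s)) % 2 := by
  haveI : NeZero n := ⟨by omega⟩
  have hn3 : 3 ≤ n := by omega
  have sh : ∀ (m : ℕ) (j : Fin n), shift m j = j + (m : Fin n) := fun m j => shift_eq_add m j
  have c2 : ((2 * h : ℕ) : Fin n) = 2 * (h : Fin n) := by rw [Nat.cast_mul, Nat.cast_ofNat]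
  have c3 : ((3 * h : ℕ) : Fin n) = 3 * (h : Fin n) := by rw [Nat.cast_mul, Nat.cast_ofNat]
  have cn : ((n - h : ℕ) : Fin n) = -(h : Fin n) := by
    rw [Nat.cast_sub (by omega : h ≤ n), Fin.natCast_self, zero_sub]
  simp only [sh, c2, c3, cn, ← sub_eq_add_neg] at hQ1 hQ2 hQ3 ⊢
  set J := kline x with hJ
  set H : Fin n := (h : Fin n) with hH
  -- non-vanishing multiples of `H`
  have N1 : (1 : Fin n) * H ≠ 0 := by rw [one_mul]; exact natCast_ne_zero_of_lt (by omega) (by omega)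
  have N2 : (2 : Fin n) * H ≠ 0 := by rw [← c2]; exact natCast_ne_zero_of_lt (by omega) (by omega)
  have N3 : (3 : Fin n) * H ≠ 0 := by rw [← c3]; exact natCast_ne_zero_of_lt (by omega) (by omega)
  have N4 : (4 : Fin n) * H ≠ 0 := by
    have c4 : ((4 * h : ℕ) : Fin n) = 4 * H := by rw [Nat.cast_mul, Nat.cast_ofNat]
    rw [← c4]; exact natCast_ne_zero_of_lt (by omega) (by omega)
  have M1 : (-1 : Fin n) * H ≠ 0 := by rwa [neg_mul, neg_ne_zero]
  have M2 : (-2 : Fin n) * H ≠ 0 := by rwa [neg_mul, neg_ne_zero]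
  have M3 : (-3 : Fin n) * H ≠ 0 := by rwa [neg_mul, neg_ne_zero]
  have M4 : (-4 : Fin n) * H ≠ 0 := by rwa [neg_mul, neg_ne_zero]
  have ne_of : ∀ (k : Fin n) {u v : Fin n}, k * H ≠ 0 → u - v = k * H → u ≠ v :=
    fun k u v hk huv e => hk (by rw [← huv, e, sub_self])
  -- the three points of `Q` are distinct
  have d12 : s + H ≠ s + 2 * H := ne_of (-1) M1 (by ring)
  have d13 : s + H ≠ s + 3 * H := ne_of (-2) M2 (by ring)
  have d23 : s + 2 * H ≠ s + 3 * H := ne_of (-1) M1 (by ring)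
  -- the family is made of even particle sets
  have h𝓕 : ∀ F ∈ evenSubsets ({s + H, s + 2 * H, s + 3 * H} : Finset (Fin n)),
      (∀ q ∈ F, J q = false) ∧ F.card % 2 = 0 := by
    intro F hF
    simp only [evenSubsets, mem_filter, mem_powerset] at hF
    refine ⟨fun q hq => ?_, hF.2⟩
    have hq' := hF.1 hq
    simp only [mem_insert, mem_singleton] at hq'
    rcases hq' with rfl | rfl | rfl
    · exact hQ1
    · exact hQ2
    · exact hQ3
  rw [master_identity hn3 (apMaj3 h) x hodd _ h𝓕]
  -- the projection of every bell
  set P := projQ (evenSubsets ({s + H, s + 2 * H, s + 3 * H} : Finset (Fin n))) (stake (apMaj3 h)) x with hPdef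
  have hPsum : ∀ j, bitVal (P j) =
      bitVal (maj3 (x (j + H)) (x (j + 2 * H)) (x (j + 3 * H))) +
      bitVal (maj3 (flipAt x {s + H, s + 2 * H} (j + H)) (flipAt x {s + H, s + 2 * H} (j + 2 * H))
        (flipAt x {s + H, s + 2 * H} (j + 3 * H))) +
      bitVal (maj3 (flipAt x {s + H, s + 3 * H} (j + H)) (flipAt x {s + H, s + 3 * H} (j + 2 * H))
        (flipAt x {s + H, s + 3 * H} (j + 3 * H))) +
      bitVal (maj3 (flipAt x {s + 2 * H, s + 3 * H} (j + H)) (flipAt x {s + 2 * H, s + 3 * H} (j + 2 * H))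
        (flipAt x {s + 2 * H, s + 3 * H} (j + 3 * H))) := by
    intro j
    rw [hPdef, bitVal_projQ, sum_evenSubsets_triple d12 d13 d23]
    simp only [stake_apMaj3, sh, c2, c3, ← hH, flipAt_empty]
  -- owner `s`
  have Ps : bitVal (P s) = 1 := by
    rw [hPsum, flipAt_pair_left, flipAt_pair_right, flipAt_pair_other x (Ne.symm d13) (Ne.symm d23),
      flipAt_pair_left, flipAt_pair_other x (Ne.symm d12) d23, flipAt_pair_right,
      flipAt_pair_other x d12 d13, flipAt_pair_left, flipAt_pair_right]
    exact sum_maj3_coset _ _ _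
  -- owner `s - H`
  have Pm : bitVal (P (s - H)) = 1 := by
    rw [hPsum]
    have r1 : s - H + H = s := by ring
    have r2 : s - H + 2 * H = s + H := by ring
    have r3 : s - H + 3 * H = s + 2 * H := by ring
    have e01 : s ≠ s + H := ne_of (-1) M1 (by ring)
    have e02 : s ≠ s + 2 * H := ne_of (-2) M2 (by ring)
    have e03 : s ≠ s + 3 * H := ne_of (-3) M3 (by ring)
    rw [r1, r2, r3, flipAt_pair_other x e01 e02, flipAt_pair_left, flipAt_pair_right,
      flipAt_pair_other x e01 e03, flipAt_pair_left, flipAt_pair_other x (Ne.symm d12) d23,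
      flipAt_pair_other x e02 e03, flipAt_pair_other x d12 d13, flipAt_pair_left]
    exact sum_maj3_two _ _ _
  -- owner `s + H`
  have Pp : bitVal (P (s + H)) = 1 := by
    rw [hPsum]
    have r1 : s + H + H = s + 2 * H := by ring
    have r2 : s + H + 2 * H = s + 3 * H := by ring
    have r3 : s + H + 3 * H = s + 4 * H := by ring
    have e41 : s + 4 * H ≠ s + H := ne_of 3 N3 (by ring)
    have e42 : s + 4 * H ≠ s + 2 * H := ne_of 2 N2 (by ring)
    have e43 : s + 4 * H ≠ s + 3 * H := ne_of 1 N1 (by ring)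
    rw [r1, r2, r3, flipAt_pair_right, flipAt_pair_other x (Ne.symm d13) (Ne.symm d23),
      flipAt_pair_other x e41 e42, flipAt_pair_other x (Ne.symm d12) d23, flipAt_pair_right,
      flipAt_pair_other x e41 e43, flipAt_pair_left, flipAt_pair_right, flipAt_pair_other x e42 e43]
    exact sum_maj3_two' _ _ _
  -- every other bell drops out
  have Pz : ∀ j, j ≠ s - H → j ≠ s → j ≠ s + H → P j = false := by
    intro j hj1 hj2 hj3
    by_cases hj0 : j = s - 2 * H
    · refine projQ_evenSubsets_eq_false _ _ x j (s + 2 * H) (s + 3 * H) d23 (by simp) (by simp) ?_ ?_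
      · refine ignores_apMaj3 h j _ ?_ ?_ ?_ <;> rw [sh] <;> simp only [c2, c3, ← hH, hj0]
        · exact ne_of 3 N3 (by ring)
        · exact ne_of 2 N2 (by ring)
        · exact ne_of 1 N1 (by ring)
      · refine ignores_apMaj3 h j _ ?_ ?_ ?_ <;> rw [sh] <;> simp only [c2, c3, ← hH, hj0]
        · exact ne_of 4 N4 (by ring)
        · exact ne_of 3 N3 (by ring)
        · exact ne_of 2 N2 (by ring)
    · refine projQ_evenSubsets_eq_false _ _ x j (s + H) (s + 2 * H) d12 (by simp) (by simp) ?_ ?_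
      · refine ignores_apMaj3 h j _ ?_ ?_ ?_ <;> rw [sh] <;> simp only [c2, c3, ← hH]
        · exact fun e => hj2 (by linear_combination -e)
        · exact fun e => hj1 (by linear_combination -e)
        · exact fun e => hj0 (by linear_combination -e)
      · refine ignores_apMaj3 h j _ ?_ ?_ ?_ <;> rw [sh] <;> simp only [c2, c3, ← hH]
        · exact fun e => hj3 (by linear_combination -e)
        · exact fun e => hj2 (by linear_combination -e)
        · exact fun e => hj1 (by linear_combination -e)
  -- assemble `Σ_j J_j P_j = J_{s-H} + J_s`
  have hsum : ∑ j, bitVal (J j) * bitVal (P j) = bitVal (J (s - H)) + bitVal (J s) := by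
    have hPT : ∀ j, bitVal (P j) = if j ∈ ({s - H, s, s + H} : Finset (Fin n)) then 1 else 0 := by
      intro j
      by_cases hj1 : j = s - H
      · rw [hj1, Pm, if_pos (by simp)]
      by_cases hj2 : j = s
      · rw [hj2, Ps, if_pos (by simp)]
      by_cases hj3 : j = s + H
      · rw [hj3, Pp, if_pos (by simp)]
      rw [Pz j hj1 hj2 hj3, if_neg (by simp [hj1, hj2, hj3])]
      rfl
    simp_rw [hPT, mul_boole]
    rw [Finset.sum_ite_mem, univ_inter]
    have em1 : s - H ≠ s := ne_of (-1) M1 (by ring)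
    have em2 : s - H ≠ s + H := ne_of (-2) M2 (by ring)
    have e01 : s ≠ s + H := ne_of (-1) M1 (by ring)
    rw [sum_insert (by simp [em1, em2]), sum_insert (by simp [e01]), sum_singleton, hQ1]
    simp [bitVal]
  -- conclude in `ℕ`
  have hl : dot2 J P < 2 := Nat.mod_lt _ two_pos
  have hr : ((J (s - H)).toNat + (J s).toNat) % 2 < 2 := Nat.mod_lt _ two_pos
  have hcast : ∀ b : Bool, ((b.toNat : ℕ) : ZMod 2) = bitVal b := by intro b; cases b <;> simp [bitVal]
  have key : ((dot2 J P : ℕ) : ZMod 2) = ((((J (s - H)).toNat + (J s).toNat) % 2 : ℕ) : ZMod 2) := by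
    rw [natCast_dot2, hsum, ZMod.natCast_mod, Nat.cast_add, hcast, hcast]
  have h' := (ZMod.natCast_eq_natCast_iff' _ _ 2).1 key
  rw [Nat.mod_mod, Nat.mod_eq_of_lt hl] at h'
  exact h'

end Summit.QuantumAdvantage.AdviceFreeQNC0.Fib19
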